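import Summits.ResolutionOfSingularities.ResolutionOfSingularities.Theorems.FrobeniusClosingPatchingRelPerfectConeDepthChartAlgebra
import Summits.ResolutionOfSingularities.ResolutionOfSingularities.Theorems.FrobeniusClosingPatchingRelPerfectJacobianCriterion
import HarnessLib

/-!
# Crux `PatchingRelPerfect` (stmt-ResolutionOfSingularities-16161), chain W5.2 — rung «r-cone-ℓ», local algebra II: KILLING CHART
# GENERATORS AND ONE HYPERSURFACE — `A/(ψ c_i, u_l, f) ≅ κ[T_j : j ∉ l]/(F)` and regularity at the prime by the Jacobian criterion

[OURS · L1 W5.2 · rung tool] Replaces the role of NO printed item; NOT a statement of the manuscript under review; fact-free,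
any characteristic, any residue field.  AI-written (AI review is weaker than expert review).

The rung «r-cone-ℓ» (res-L1-w52-stub-4 g4, crux `PatchingRelPerfect` stmt-ResolutionOfSingularities-16161, line
`closed_point_slice`, open stub `stub_atomDimFourBlowup`): the member `I = (x₀x₁ + x₂²) + 𝔪^{ℓ+2}` — the quadric CONE at
exceptional depth `ℓ` — lies in the companion class for EVERY `ℓ ≥ 1`.  It is the minimal family with an `(ℓ, 2)`-DEFICIENT step
(CHAIN v2.1 kernel sentence (v″): the vertex of `V(q̄) ⊂ ℙ³` is an ordinary double point, of weight `2 < ℓ` for `ℓ ≥ 3`), resolved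
by `⌈ℓ/2⌉` blowings up of successive vertices (each reproducing the cone on the new exceptional carrier at depth `ℓ - 2`:
`u²·((y₀/u)(y₁/u) + (y₂/u)², u^{ℓ-2})`) followed by the two-monomial END game (`atomConclusion_of_pointwiseTwoMonomial`).

This file (continuing `…ConeDepthChartAlgebra`, same abstract chart data with residue-field coefficients): for a duplicate-free
list `l` of chart generators `u_j ∈ 𝔓` and one element `f ∈ 𝔓` with a polynomial representative `F ∈ κ[T_j : j ∉ l]`,
* `killIdeal`, `exists_quotKillIdealEquiv` — `A/(ψ c_i, u_l, f) ≅ κ[T_j : j ∉ l]/(F)` (through `ε`, `DoubleQuot`, and the tree's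
  `MvPolynomial.quotientSpanXEquiv`), tracking classes of polynomials not involving the killed variables;
* `isRegularLocalRing_atPrime_killIdeal` — `A/K₀` is regular at `𝔓/K₀` as soon as some partial derivative `∂F/∂T_j` has a lift
  outside `𝔓` (the tree's pointwise Jacobian criterion `MvPolynomial.isRegularLocalRing_atPrime_quotient_of_pderiv_notMem`);
* **`isRsopPart_kill_hypersurface`** — then `(ψ c_i, u_l, f)` is part of a regular system of parameters of `L` (`F ≠ 0` gives the
  weak regularity of `F` modulo the variables, `κ[T_j : j ∉ l]` being a domain).

## References
* H. Matsumura, *Commutative Ring Theory*, CUP 1986, Thm. 14.2 (and the Remark after it), Thm. 17.4. [Matsumura1987]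
* The Stacks Project, Tags 0804, 0BIQ (charts of a blowing up, `B_i/(c_i) ≅ (R/I)[T]`). [StacksProject]
* J. Kollár, *Lectures on Resolution of Singularities* (2007), Def. 3.24, (3.111) Step 3. [Kollar2007]
-/

-- `Summit.<Summit>.<Sub>.Theorems` with `Sub = Summit` (single-conjunct summit, D-0017)
set_option linter.dupNamespace false

noncomputable section

open IsLocalRing Literature.AlgebraicGeometry.Resolution
open scoped Pointwise

namespace Summit.ResolutionOfSingularities.ResolutionOfSingularities.Theorems

universe u v w

namespace ConeDepth

section AbstractChart

variable {R : Type u} [CommRing R] [IsRegularLocalRing R] {n : ℕ} (c : Fin n → R) (i : Fin n)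
  (hz : Ideal.span (Set.range c) = maximalIdeal R) (hd : (maximalIdeal R).spanFinrank = n)
  {A : Type u} [CommRing A] (L : Type u) [CommRing L] (ψ : R →+* A) (u : Fin n → A)
  (hnzd : ψ (c i) ∈ nonZeroDivisors A)
  (ε : MvPolynomial {j : Fin n // j ≠ i} (ResidueField R) ≃+* A ⧸ Ideal.span {ψ (c i)})
  (hεC : ∀ r : R, ε (MvPolynomial.C (residue R r)) = Ideal.Quotient.mk _ (ψ r))
  (hεX : ∀ j : {j : Fin n // j ≠ i}, ε (MvPolynomial.X j) = Ideal.Quotient.mk _ (u j.1))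
  (𝔓 : Ideal A) [𝔓.IsPrime] (h𝔓 : 𝔓.comap ψ = maximalIdeal R)
  [Algebra A L] [IsLocalization.AtPrime L 𝔓]

local notation3 "I" => Ideal.span (Set.range c)
local notation3 "P" => MvPolynomial {j : Fin n // j ≠ i} (ResidueField R)
local notation3 "KA" => Ideal.span {ψ (c i)}
local notation3 "KL" => Ideal.map (algebraMap A L) (Ideal.span {ψ (c i)})
local notation3 "Lb" => L ⧸ KL


/-! ## §3 Killing chart generators and one hypersurface: `A/(ψ c_i, u_l, f) ≅ κ[T_j : j ∉ l]/(F)`, and regularity at the prime -/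

section KillAndHypersurface

variable (l : List {j : Fin n // j ≠ i}) (hl : l.Nodup)

local notation3 "sl" => {j : {j : Fin n // j ≠ i} | j ∈ l}
local notation3 "Ps" => MvPolynomial {j : {j : Fin n // j ≠ i} // j ∉ {j : {j : Fin n // j ≠ i} | j ∈ l}}
  (ResidueField R)

/-- A map over a list as an `ofFn` along `List.get`. [folklore] -/
theorem _root_.List.map_eq_ofFn_get {α β : Type*} (l : List α) (g : α → β) :
    l.map g = List.ofFn (fun k : Fin l.length => g (l.get k)) := by
  conv_lhs => rw [← List.ofFn_get l]
  rw [List.map_ofFn]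
  rfl

/-- The `Fin`-family `(u_l, f)` of the killed generators followed by the hypersurface. [folklore] -/
def killFamily (f : A) : Fin (l.length + 1) → A :=
  Fin.append (fun k : Fin l.length => u (l.get k).1) (fun _ : Fin 1 => f)

/-- The ideal `K₀ = (ψ c_i, (u_j)_{j ∈ l}, f) ⊆ A` killed at a point of the chart. [folklore] -/
def killIdeal (f : A) : Ideal A :=
  Ideal.ofList (ψ (c i) :: List.ofFn (killFamily i u l f))

omit [IsRegularLocalRing R] [CommRing A] [𝔓.IsPrime] [IsLocalization.AtPrime L 𝔓] [Algebra A L] in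
/-- The list of the killed family. [folklore] -/
theorem ofFn_killFamily (f : A) : List.ofFn (killFamily i u l f) = (l.map fun j => u j.1) ++ [f] := by
  rw [killFamily, List.ofFn_fin_append, List.map_eq_ofFn_get, List.ofFn_const, List.replicate_one]

omit [IsRegularLocalRing R] [𝔓.IsPrime] [IsLocalization.AtPrime L 𝔓] [Algebra A L] in
/-- `(ψ c_i) ⊆ K₀`. [folklore] -/
theorem span_le_killIdeal (f : A) : KA ≤ killIdeal c i ψ u l f := by
  rw [killIdeal, Ideal.ofList_cons]
  exact le_sup_left

omit [𝔓.IsPrime] [IsLocalization.AtPrime L 𝔓] [Algebra A L] in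
include hεX in
/-- Modulo `ψ c_i`, the ideal `K₀` is the image under `ε` of `(T_l, F)`. [folklore] -/
theorem map_mk_killIdeal (f : A) (F : Ps) (hfF : ε (MvPolynomial.rename Subtype.val F) = Ideal.Quotient.mk _ f) :
    (killIdeal c i ψ u l f).map (Ideal.Quotient.mk KA) =
      (Ideal.span (MvPolynomial.X '' sl) ⊔ Ideal.span {MvPolynomial.rename Subtype.val F}).map
        (ε : P →+* A ⧸ KA) := by
  have h0 : Ideal.span {Ideal.Quotient.mk KA (ψ (c i))} = ⊥ :=
    Ideal.span_singleton_eq_bot.mpr (Ideal.Quotient.eq_zero_iff_mem.mpr (Ideal.subset_span rfl))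
  rw [killIdeal, ofFn_killFamily, Ideal.map_ofList, List.map_cons, Ideal.ofList_cons, h0, bot_sup_eq,
    List.map_append, Ideal.ofList_append, Ideal.map_sup, Ideal.map_span, Ideal.map_span, Set.image_singleton]
  congr 1
  · rw [Ideal.ofList, List.map_map]
    congr 1
    ext x
    simp only [Set.mem_setOf_eq, List.mem_map, Function.comp_apply, Set.mem_image]
    constructor
    · rintro ⟨j, hj, rfl⟩
      exact ⟨MvPolynomial.X j, ⟨j, hj, rfl⟩, by rw [RingHom.coe_coe, hεX]⟩
    · rintro ⟨_, ⟨j, hj, rfl⟩, rfl⟩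
      exact ⟨j, hj, by rw [RingHom.coe_coe, hεX]⟩
  · rw [Ideal.ofList, List.map_singleton, RingHom.coe_coe, hfF]
    congr 1
    ext x
    simp

/-- `κ[T]/(T_l, F) ≅ κ[T_j : j ∉ l]/(F)` (kill the variables). [folklore] -/
def quotKillEquiv (F : Ps) :
    (P ⧸ (Ideal.span (MvPolynomial.X '' sl) ⊔ Ideal.span {MvPolynomial.rename Subtype.val F})) ≃+*
      Ps ⧸ Ideal.span {F} :=
  (DoubleQuot.quotQuotEquivQuotSup _ _).symm.trans
    (Ideal.quotientEquiv _ _ (MvPolynomial.quotientSpanXEquiv sl).toRingEquiv (by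
      rw [Ideal.map_map, Ideal.map_span, Set.image_singleton]
      congr 2
      change F = MvPolynomial.quotientSpanXEquiv sl (Ideal.Quotient.mk _ (MvPolynomial.rename Subtype.val F))
      rw [MvPolynomial.quotientSpanXEquiv_mk, MvPolynomial.killCompl_rename_app]))

/-- `quotKillEquiv` on the class of a polynomial not involving the killed variables. [folklore] -/
theorem quotKillEquiv_mk (F G : Ps) :
    quotKillEquiv i l F (Ideal.Quotient.mk _ (MvPolynomial.rename Subtype.val G)) = Ideal.Quotient.mk _ G := by
  rw [quotKillEquiv, RingEquiv.trans_apply, DoubleQuot.quotQuotEquivQuotSup_symm_quotQuotMk, DoubleQuot.quotQuotMk,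
    RingHom.comp_apply]
  erw [Ideal.quotientEquiv_mk]
  change Ideal.Quotient.mk _ (MvPolynomial.quotientSpanXEquiv sl (Ideal.Quotient.mk _ _)) = _
  rw [MvPolynomial.quotientSpanXEquiv_mk, MvPolynomial.killCompl_rename_app]

include hεX in
omit [𝔓.IsPrime] [IsLocalization.AtPrime L 𝔓] [Algebra A L] in
/-- **`A/K₀ ≅ κ[T_j : j ∉ l]/(F)`**, sending the class of `a` to the class of `G` whenever `ε(G) = ā` (`G` not involving the
killed variables). [folklore] -/
theorem exists_quotKillIdealEquiv (f : A) (F : Ps) (hfF : ε (MvPolynomial.rename Subtype.val F) = Ideal.Quotient.mk _ f) :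
    ∃ eK : (A ⧸ killIdeal c i ψ u l f) ≃+* Ps ⧸ Ideal.span {F},
      ∀ (a : A) (G : Ps), ε (MvPolynomial.rename Subtype.val G) = Ideal.Quotient.mk _ a →
        eK (Ideal.Quotient.mk _ a) = Ideal.Quotient.mk _ G := by
  have hle := span_le_killIdeal c i ψ u l f
  have hK₀ := map_mk_killIdeal c i ψ u ε hεX l f F hfF
  let e2 : (P ⧸ (Ideal.span (MvPolynomial.X '' sl) ⊔ Ideal.span {MvPolynomial.rename Subtype.val F})) ≃+*
      (A ⧸ KA) ⧸ (killIdeal c i ψ u l f).map (Ideal.Quotient.mk KA) :=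
    Ideal.quotientEquiv _ _ ε hK₀
  refine ⟨((DoubleQuot.quotQuotEquivQuotOfLE hle).symm.trans e2.symm).trans (quotKillEquiv i l F),
    fun a G hG => ?_⟩
  rw [RingEquiv.trans_apply, RingEquiv.trans_apply, DoubleQuot.quotQuotEquivQuotOfLE_symm_mk]
  have h2 : e2 (Ideal.Quotient.mk _ (MvPolynomial.rename Subtype.val G)) =
      DoubleQuot.quotQuotMk KA (killIdeal c i ψ u l f) a := by
    change Ideal.Quotient.mk _ (ε _) = _
    rw [hG]
    rfl
  rw [← h2, RingEquiv.symm_apply_apply, quotKillEquiv_mk]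

include hεX in
omit [𝔓.IsPrime] [IsLocalization.AtPrime L 𝔓] [Algebra A L] in
/-- **Regularity of `A/K₀` at the prime `𝔓/K₀` by the Jacobian criterion on the polynomial side**: `K₀ = (ψ c_i, u_l, f) ⊆ 𝔓`,
`F` the representative of `f` not involving the killed variables; if some partial derivative `∂F/∂T_j` has a lift `a ∉ 𝔓`, then
`A/K₀ ≅ κ[T_j : j ∉ l]/(F)` is regular at `𝔓/K₀`. [cite: Matsumura1987, Thm. 14.2] -/
theorem isRegularLocalRing_atPrime_killIdeal (f : A) (F : Ps)
    (hfF : ε (MvPolynomial.rename Subtype.val F) = Ideal.Quotient.mk _ f)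
    (hK : killIdeal c i ψ u l f ≤ 𝔓) (jv : {j : {j : Fin n // j ≠ i} // j ∉ sl}) (a : A)
    (hGa : ε (MvPolynomial.rename Subtype.val (MvPolynomial.pderiv jv F)) = Ideal.Quotient.mk _ a) (ha : a ∉ 𝔓)
    [(𝔓.map (Ideal.Quotient.mk (killIdeal c i ψ u l f))).IsPrime] :
    IsRegularLocalRing (Localization.AtPrime (𝔓.map (Ideal.Quotient.mk (killIdeal c i ψ u l f)))) := by
  classical
  haveI : IsRegularRing Ps := inferInstance
  obtain ⟨eK, heK⟩ := exists_quotKillIdealEquiv c i ψ u ε hεX l f F hfF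
  set pbar := 𝔓.map (Ideal.Quotient.mk (killIdeal c i ψ u l f)) with hpbar
  have hG : Ideal.Quotient.mk _ (MvPolynomial.pderiv jv F) ∉ pbar.comap eK.symm := by
    intro hmem
    rw [Ideal.mem_comap, ← heK a _ hGa, RingEquiv.symm_apply_apply, hpbar, ← Ideal.mem_comap,
      Ideal.comap_map_of_surjective _ Ideal.Quotient.mk_surjective, ← RingHom.ker_eq_comap_bot, Ideal.mk_ker,
      sup_eq_left.mpr hK] at hmem
    exact ha hmem
  haveI := MvPolynomial.isRegularLocalRing_atPrime_quotient_of_pderiv_notMem (pbar.comap eK.symm) jv hG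
  exact isRegularLocalRing_atPrime_of_ringEquiv eK.symm pbar

omit [𝔓.IsPrime] [IsLocalization.AtPrime L 𝔓] [Algebra A L] in
/-- A non-zero polynomial not involving the killed variables acts injectively on `κ[T]/(T_l)` (a domain, `κ` being the
residue FIELD of `R`). [folklore] -/
theorem isSMulRegular_quotient_span_X_rename (F : Ps) (hF0 : F ≠ 0) :
    IsSMulRegular (P ⧸ Ideal.span (MvPolynomial.X '' sl : Set P)) (MvPolynomial.rename Subtype.val F : P) := by
  apply isSMulRegular_quotient_of_isLeftRegular
  intro x y hxy
  apply (MvPolynomial.quotientSpanXEquiv (R := ResidueField R) sl).injective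
  have h := congrArg (MvPolynomial.quotientSpanXEquiv (R := ResidueField R) sl) hxy
  simp only [map_mul, MvPolynomial.quotientSpanXEquiv_mk, MvPolynomial.killCompl_rename_app] at h
  exact (IsRegular.of_ne_zero' hF0).left h

include hl hz hnzd hεX h𝔓 in
/-- **The chart family with killed generators and one hypersurface is part of a regular system of parameters** of `L`:
for a duplicate-free list `l` of indices `j ≠ i` with `u_j ∈ 𝔓`, and `f ∈ 𝔓` with a non-zero polynomial representative `F`
not involving the `T_l` some partial derivative of which has a lift `a ∉ 𝔓`, the family `(ψ c_i, u_l, f)` is part of a regular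
system of parameters of `L`. [cite: Matsumura1987, Thm. 14.2] -/
theorem isRsopPart_kill_hypersurface [IsNoetherianRing A] [IsLocalRing L]
    (hlu : ∀ j ∈ l, u j.1 ∈ 𝔓) (f : A) (hf : f ∈ 𝔓) (F : Ps) (hF0 : F ≠ 0)
    (hfF : ε (MvPolynomial.rename Subtype.val F) = Ideal.Quotient.mk _ f)
    (jv : {j : {j : Fin n // j ≠ i} // j ∉ sl}) (a : A)
    (hGa : ε (MvPolynomial.rename Subtype.val (MvPolynomial.pderiv jv F)) = Ideal.Quotient.mk _ a) (ha : a ∉ 𝔓) :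
    IsRsopPart (consFamily c i L ψ (killFamily i u l f)) := by
  classical
  -- the killed ideal lies in `𝔓`
  have hK : killIdeal c i ψ u l f ≤ 𝔓 := by
    rw [killIdeal, ofFn_killFamily, Ideal.ofList, Ideal.span_le]
    intro x hx
    simp only [Set.mem_setOf_eq, List.mem_cons, List.mem_append, List.mem_map, List.not_mem_nil, or_false] at hx
    rcases hx with rfl | ⟨j, hj, rfl⟩ | rfl
    · exact map_centre_mem' c hz ψ 𝔓 h𝔓 i
    · exact hlu j hj
    · exact hf
  -- regularity of `L/K₀L`
  haveI := isPrime_map_mk 𝔓 _ hK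
  haveI := isRegularLocalRing_atPrime_killIdeal c i ψ u ε hεX 𝔓 l f F hfF hK jv a hGa ha
  haveI : IsRegularLocalRing (L ⧸ (Ideal.ofList (ψ (c i) :: List.ofFn (killFamily i u l f))).map (algebraMap A L)) := by
    have h := isRegularLocalRing_quot_map_of_atPrime L 𝔓 (killIdeal c i ψ u l f) hK
    rwa [killIdeal] at h
  -- the polynomial representatives and their weak regularity
  refine isRsopPart_consFamily c i hz L ψ hnzd ε 𝔓 h𝔓 _ ?_
    (Fin.append (fun k : Fin l.length => MvPolynomial.X (l.get k)) (fun _ : Fin 1 => MvPolynomial.rename Subtype.val F))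
    ?_ ?_
  · intro k
    induction k using Fin.addCases with
    | left k => rw [killFamily, Fin.append_left]; exact hlu _ (List.get_mem l k)
    | right k => rw [killFamily, Fin.append_right]; exact hf
  · intro k
    induction k using Fin.addCases with
    | left k => rw [killFamily, Fin.append_left, Fin.append_left, hεX]
    | right k => rw [killFamily, Fin.append_right, Fin.append_right, hfF]
  · rw [List.ofFn_fin_append, RingTheory.Sequence.isWeaklyRegular_append_iff]
    constructor
    · have h := MvPolynomial.isWeaklyRegular_map_X (R := ResidueField R) l hl
      rwa [List.map_eq_ofFn_get] at h
    · -- modulo the variables: `F ≠ 0` in the domain `κ[T_j : j ∉ l]`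
      rw [List.ofFn_const, List.replicate_one, RingTheory.Sequence.isWeaklyRegular_singleton_iff]
      have hideal : (Ideal.ofList (List.ofFn fun k : Fin l.length => (MvPolynomial.X (l.get k) : P)) • ⊤ :
          Submodule P P) = Ideal.span (MvPolynomial.X '' sl : Set P) := by
        rw [smul_eq_mul, Ideal.mul_top, Ideal.ofList, ← List.map_eq_ofFn_get]
        congr 1
        ext p
        simp
      rw [hideal]
      exact isSMulRegular_quotient_span_X_rename i l F hF0

end KillAndHypersurface

end AbstractChart

end ConeDepth

end Summit.ResolutionOfSingularities.ResolutionOfSingularities.Theorems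

end
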